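import Mathlib.RingTheory.MvPolynomial.EulerIdentity
import Mathlib.Algebra.MvPolynomial.PDeriv
import Mathlib.Algebra.MvPolynomial.Eval
import Mathlib.RingTheory.MvPolynomial.Homogeneous
import Mathlib.Data.ZMod.Basic
import Mathlib.Tactic.LinearCombination
import Mathlib.Tactic.NormNum
import Mathlib.Tactic.Ring
import HarnessLib

/-!
# Euler readings of a quintic-plus-quartics potential along the point direction (CARVER task T42)

INSTRUMENT, NOT a resolution theorem: the pure-algebra core of LEMMA Λ₅⁺♮ (THEOREM-L5N eng1-g36
§10, item E6) of ENGINE 1's polynomial weighted-centre TOY MODEL `W(f)` — the step that replaced the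
g34 polarisation argument is Euler's identity applied to the homogeneous pieces (degrees `4` and `3`)
of a directional derivative `∂_z Φ` of `Φ = F₀ + Σ_y n_y F_y` (`F₀` a quintic and `F_y` quartics in
the middle variables, `n_y` scalars), read along the direction of the evaluation point `b` itself.

Contents (over any commutative ring `K`, variables indexed by a finite type `σ`):
* `dirDeriv z F = Σ_i z_i • ∂F/∂X_i`, the directional derivative `∂_z F` with a constant direction
  `z : σ → K`; additivity, scalars, finite sums, `dirDeriv_potential`, evaluation `eval_dirDeriv`,
  and `isHomogeneous_dirDeriv` (degree drops by one; Mathlib's `IsHomogeneous.pderiv`);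
* Euler along the point: for `G` homogeneous of degree `d`, `(D_b G)(b) = d · G(b)`
  (`eval_dirDeriv_self`, = Mathlib's `IsHomogeneous.sum_X_mul_pderiv` evaluated at `b`) and
  `(D_b² G)(b) = d (d - 1) · G(b)` (`eval_dirDeriv_dirDeriv_self`);
* T42 CLAIM (`euler_readings`): `D_b(∂_zΦ)(b) = 4 (∂_zF₀)(b) + 3 Σ_y n_y (∂_zF_y)(b)` and
  `D_b²(∂_zΦ)(b) = 12 (∂_zF₀)(b) + 6 Σ_y n_y (∂_zF_y)(b)` (the un-halved form of the engine's
  `½ D_b² = 6 · + 3 ·` reading);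
* COROLLARY (`euler_readings_vanish`, `_of_ne_zero`, `_zmod`): if `2` and `3` are units of `K`
  (a field of characteristic `≠ 2, 3`; `ZMod p` for a prime `p ≥ 5`) and both readings vanish, then
  `(∂_zF₀)(b) = 0` and `Σ_y n_y (∂_zF_y)(b) = 0`.

Bookkeeping only; NOT a statement about the Abramovich–Temkin–Włodarczyk invariant; nothing here is
summit progress; AI-written, AI review weaker than expert review.  Reference (context only):
[AbramovichTemkinWlodarczyk2024] §5.
-/

namespace Literature.AlgebraicGeometry.Resolution.WeightedBlowup

namespace EulerReadings

open MvPolynomial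

variable {K : Type*} [CommRing K] {σ : Type*} [Fintype σ]

/-- The directional derivative `∂_z F = Σ_i z_i • ∂F/∂X_i` with a constant direction `z : σ → K`.
[cite: AbramovichTemkinWlodarczyk2024, §5] -/
noncomputable def dirDeriv (z : σ → K) (F : MvPolynomial σ K) : MvPolynomial σ K :=
  ∑ i, z i • pderiv i F

/-- `∂_z` is additive. [cite: AbramovichTemkinWlodarczyk2024, §5] -/
theorem dirDeriv_add (z : σ → K) (F G : MvPolynomial σ K) :
    dirDeriv z (F + G) = dirDeriv z F + dirDeriv z G := by
  simp only [dirDeriv, map_add, smul_add, Finset.sum_add_distrib]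

/-- `∂_z` commutes with scalars. [cite: AbramovichTemkinWlodarczyk2024, §5] -/
theorem dirDeriv_smul (z : σ → K) (c : K) (F : MvPolynomial σ K) :
    dirDeriv z (c • F) = c • dirDeriv z F := by
  simp only [dirDeriv, (pderiv _).map_smul, Finset.smul_sum, smul_smul, mul_comm c]

/-- `∂_z` of a finite sum. [cite: AbramovichTemkinWlodarczyk2024, §5] -/
theorem dirDeriv_sum (z : σ → K) {ι : Type*} (s : Finset ι) (f : ι → MvPolynomial σ K) :
    dirDeriv z (∑ y ∈ s, f y) = ∑ y ∈ s, dirDeriv z (f y) := by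
  simp only [dirDeriv, map_sum, Finset.smul_sum]
  exact Finset.sum_comm

/-- `∂_z (F₀ + Σ_y n_y • F_y) = ∂_z F₀ + Σ_y n_y • ∂_z F_y` (linearity of `∂_z` on a potential).
[cite: AbramovichTemkinWlodarczyk2024, §5] -/
theorem dirDeriv_potential (z : σ → K) {ι : Type*} (s : Finset ι) (F₀ : MvPolynomial σ K)
    (F : ι → MvPolynomial σ K) (n : ι → K) :
    dirDeriv z (F₀ + ∑ y ∈ s, n y • F y) = dirDeriv z F₀ + ∑ y ∈ s, n y • dirDeriv z (F y) := by
  rw [dirDeriv_add, dirDeriv_sum]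
  simp only [dirDeriv_smul]

/-- Evaluation of `∂_z F` at a point `b`: `Σ_i z_i · (∂_i F)(b)`.
[cite: AbramovichTemkinWlodarczyk2024, §5] -/
theorem eval_dirDeriv (b z : σ → K) (F : MvPolynomial σ K) :
    eval b (dirDeriv z F) = ∑ i, z i * eval b (pderiv i F) := by
  simp only [dirDeriv, map_sum, smul_eval]

/-- `∂_z` lowers the degree of a homogeneous polynomial by one (from Mathlib's
`IsHomogeneous.pderiv`). [cite: AbramovichTemkinWlodarczyk2024, §5] -/
theorem isHomogeneous_dirDeriv {F : MvPolynomial σ K} {d : ℕ} (h : F.IsHomogeneous (d + 1))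
    (z : σ → K) : (dirDeriv z F).IsHomogeneous d := by
  unfold dirDeriv
  apply IsHomogeneous.sum
  intro i _
  have hp : (pderiv i F).IsHomogeneous d := by simpa using h.pderiv (i := i)
  simpa [smul_eq_C_mul] using hp.C_mul (z i)

/-- **Euler along the point.** For `G` homogeneous of degree `d`:
`(D_b G)(b) = Σ_i b_i (∂_i G)(b) = d · G(b)` — Euler's identity `Σ_i X_i ∂_i G = d G` evaluated
at `b`. [cite: AbramovichTemkinWlodarczyk2024, §5] -/
theorem eval_dirDeriv_self {G : MvPolynomial σ K} {d : ℕ} (h : G.IsHomogeneous d) (b : σ → K) :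
    eval b (dirDeriv b G) = d * eval b G := by
  have e := congrArg (eval b) h.sum_X_mul_pderiv
  rw [map_sum] at e
  simp only [map_mul, eval_X, nsmul_eq_mul, map_natCast] at e
  rw [eval_dirDeriv]
  exact e

/-- **Second Euler reading.** For `G` homogeneous of degree `d + 1`:
`(D_b² G)(b) = (d + 1) d · G(b)` (apply `eval_dirDeriv_self` to `D_b G`, homogeneous of degree `d`,
then to `G`). [cite: AbramovichTemkinWlodarczyk2024, §5] -/
theorem eval_dirDeriv_dirDeriv_self {G : MvPolynomial σ K} {d : ℕ} (h : G.IsHomogeneous (d + 1))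
    (b : σ → K) : eval b (dirDeriv b (dirDeriv b G)) = (d + 1) * d * eval b G := by
  rw [eval_dirDeriv_self (isHomogeneous_dirDeriv h b) b, eval_dirDeriv_self h b]
  push_cast
  ring

/-- **T42 CLAIM (Euler readings of `∂_zΦ` along the point direction).** `F₀` homogeneous of degree
`5`, `F_y` homogeneous of degree `4` (`y ∈ s`), scalars `n_y`, `Φ = F₀ + Σ_y n_y • F_y`, point `b`,
direction `z`:
`D_b(∂_zΦ)(b) = 4 (∂_zF₀)(b) + 3 Σ_y n_y (∂_zF_y)(b)` and
`D_b²(∂_zΦ)(b) = 12 (∂_zF₀)(b) + 6 Σ_y n_y (∂_zF_y)(b)`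
(Euler for the homogeneous pieces `∂_zF₀` (degree `4`) and `∂_zF_y` (degree `3`) of `∂_zΦ`; the
engine's `½ D_b²` reading is `6 · + 3 ·`). [cite: AbramovichTemkinWlodarczyk2024, §5] -/
theorem euler_readings {ι : Type*} (s : Finset ι) (F₀ : MvPolynomial σ K)
    (F : ι → MvPolynomial σ K) (n : ι → K) (h0 : F₀.IsHomogeneous 5)
    (hF : ∀ y ∈ s, (F y).IsHomogeneous 4) (b z : σ → K) :
    eval b (dirDeriv b (dirDeriv z (F₀ + ∑ y ∈ s, n y • F y))) =
        4 * eval b (dirDeriv z F₀) + 3 * ∑ y ∈ s, n y * eval b (dirDeriv z (F y)) ∧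
      eval b (dirDeriv b (dirDeriv b (dirDeriv z (F₀ + ∑ y ∈ s, n y • F y)))) =
        12 * eval b (dirDeriv z F₀) + 6 * ∑ y ∈ s, n y * eval b (dirDeriv z (F y)) := by
  have h0' : (dirDeriv z F₀).IsHomogeneous 4 := isHomogeneous_dirDeriv (d := 4) h0 z
  have hF' : ∀ y ∈ s, (dirDeriv z (F y)).IsHomogeneous 3 :=
    fun y hy => isHomogeneous_dirDeriv (d := 3) (hF y hy) z
  have e1 : ∀ y ∈ s, eval b (dirDeriv b (dirDeriv z (F y))) = 3 * eval b (dirDeriv z (F y)) :=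
    fun y hy => by simpa using eval_dirDeriv_self (hF' y hy) b
  have e2 : ∀ y ∈ s, eval b (dirDeriv b (dirDeriv b (dirDeriv z (F y)))) =
      6 * eval b (dirDeriv z (F y)) := fun y hy => by
    have e := eval_dirDeriv_dirDeriv_self (d := 2) (hF' y hy) b
    rw [e]
    push_cast
    ring
  have s1 : ∑ y ∈ s, eval b (n y • dirDeriv b (dirDeriv z (F y))) =
      3 * ∑ y ∈ s, n y * eval b (dirDeriv z (F y)) := by
    rw [Finset.mul_sum]
    exact Finset.sum_congr rfl fun y hy => by rw [smul_eval, e1 y hy]; ring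
  have s2 : ∑ y ∈ s, eval b (n y • dirDeriv b (dirDeriv b (dirDeriv z (F y)))) =
      6 * ∑ y ∈ s, n y * eval b (dirDeriv z (F y)) := by
    rw [Finset.mul_sum]
    exact Finset.sum_congr rfl fun y hy => by rw [smul_eval, e2 y hy]; ring
  refine ⟨?_, ?_⟩
  · rw [dirDeriv_potential, dirDeriv_potential, map_add, map_sum, eval_dirDeriv_self h0' b, s1]
    push_cast
    ring
  · rw [dirDeriv_potential, dirDeriv_potential, dirDeriv_potential, map_add, map_sum,
      eval_dirDeriv_dirDeriv_self (d := 3) h0' b, s2]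
    push_cast
    ring

/-- **COROLLARY (vanishing readings).** If `2` and `3` are units of `K` and both Euler readings of
`∂_zΦ` at `b` vanish, `D_b(∂_zΦ)(b) = D_b²(∂_zΦ)(b) = 0`, then `(∂_zF₀)(b) = 0` and
`Σ_y n_y (∂_zF_y)(b) = 0` (the `2 × 2` system `4a + 3c = 0`, `12a + 6c = 0` has determinant `-12`).
[cite: AbramovichTemkinWlodarczyk2024, §5] -/
theorem euler_readings_vanish {ι : Type*} (s : Finset ι) (F₀ : MvPolynomial σ K)
    (F : ι → MvPolynomial σ K) (n : ι → K) (h0 : F₀.IsHomogeneous 5)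
    (hF : ∀ y ∈ s, (F y).IsHomogeneous 4) (b z : σ → K) (h2 : IsUnit (2 : K))
    (h3 : IsUnit (3 : K))
    (hD1 : eval b (dirDeriv b (dirDeriv z (F₀ + ∑ y ∈ s, n y • F y))) = 0)
    (hD2 : eval b (dirDeriv b (dirDeriv b (dirDeriv z (F₀ + ∑ y ∈ s, n y • F y)))) = 0) :
    eval b (dirDeriv z F₀) = 0 ∧ ∑ y ∈ s, n y * eval b (dirDeriv z (F y)) = 0 := by
  obtain ⟨e1, e2⟩ := euler_readings s F₀ F n h0 hF b z
  rw [e1] at hD1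
  rw [e2] at hD2
  have h4 : IsUnit (4 : K) := by
    rw [show (4 : K) = 2 * 2 by norm_num]
    exact h2.mul h2
  have ha : eval b (dirDeriv z F₀) = 0 :=
    h4.mul_right_eq_zero.mp (by linear_combination hD2 - 2 * hD1)
  have hc : ∑ y ∈ s, n y * eval b (dirDeriv z (F y)) = 0 :=
    h3.mul_right_eq_zero.mp (by linear_combination hD1 - 4 * ha)
  exact ⟨ha, hc⟩

/-- The corollary over a field in which `2 ≠ 0` and `3 ≠ 0` (characteristic `≠ 2, 3`).
[cite: AbramovichTemkinWlodarczyk2024, §5] -/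
theorem euler_readings_vanish_of_ne_zero {L : Type*} [Field L] {ι : Type*} (s : Finset ι)
    (F₀ : MvPolynomial σ L) (F : ι → MvPolynomial σ L) (n : ι → L) (h0 : F₀.IsHomogeneous 5)
    (hF : ∀ y ∈ s, (F y).IsHomogeneous 4) (b z : σ → L) (h2 : (2 : L) ≠ 0) (h3 : (3 : L) ≠ 0)
    (hD1 : eval b (dirDeriv b (dirDeriv z (F₀ + ∑ y ∈ s, n y • F y))) = 0)
    (hD2 : eval b (dirDeriv b (dirDeriv b (dirDeriv z (F₀ + ∑ y ∈ s, n y • F y)))) = 0) :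
    eval b (dirDeriv z F₀) = 0 ∧ ∑ y ∈ s, n y * eval b (dirDeriv z (F y)) = 0 :=
  euler_readings_vanish s F₀ F n h0 hF b z (isUnit_iff_ne_zero.mpr h2)
    (isUnit_iff_ne_zero.mpr h3) hD1 hD2

/-- `2` and `3` are units of `ZMod p` for a prime `p ≥ 5` (the cells `p ∤ 6` of the toy model).
[cite: AbramovichTemkinWlodarczyk2024, §5] -/
theorem isUnit_two_three_zmod (p : ℕ) (hp : p.Prime) (h5 : 5 ≤ p) :
    IsUnit (2 : ZMod p) ∧ IsUnit (3 : ZMod p) := by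
  have h2 : IsUnit ((2 : ℕ) : ZMod p) :=
    (ZMod.isUnit_iff_coprime 2 p).mpr ((Nat.coprime_primes Nat.prime_two hp).mpr (by omega))
  have h3 : IsUnit ((3 : ℕ) : ZMod p) :=
    (ZMod.isUnit_iff_coprime 3 p).mpr ((Nat.coprime_primes Nat.prime_three hp).mpr (by omega))
  exact ⟨by simpa using h2, by simpa using h3⟩

/-- The corollary over `ZMod p`, `p ≥ 5` prime: vanishing of both Euler readings of `∂_zΦ` at `b`
forces `(∂_zF₀)(b) = 0` and `Σ_y n_y (∂_zF_y)(b) = 0`. [cite: AbramovichTemkinWlodarczyk2024, §5] -/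
theorem euler_readings_vanish_zmod (p : ℕ) (hp : p.Prime) (h5 : 5 ≤ p) {ι : Type*}
    (s : Finset ι) (F₀ : MvPolynomial σ (ZMod p)) (F : ι → MvPolynomial σ (ZMod p))
    (n : ι → ZMod p) (h0 : F₀.IsHomogeneous 5) (hF : ∀ y ∈ s, (F y).IsHomogeneous 4)
    (b z : σ → ZMod p)
    (hD1 : eval b (dirDeriv b (dirDeriv z (F₀ + ∑ y ∈ s, n y • F y))) = 0)
    (hD2 : eval b (dirDeriv b (dirDeriv b (dirDeriv z (F₀ + ∑ y ∈ s, n y • F y)))) = 0) :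
    eval b (dirDeriv z F₀) = 0 ∧ ∑ y ∈ s, n y * eval b (dirDeriv z (F y)) = 0 :=
  euler_readings_vanish s F₀ F n h0 hF b z (isUnit_two_three_zmod p hp h5).1
    (isUnit_two_three_zmod p hp h5).2 hD1 hD2

end EulerReadings

end Literature.AlgebraicGeometry.Resolution.WeightedBlowup
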